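import Summits.CriticalPhenomena.PercolationContinuityZ3.Theorems.Transplant.FKConnectivityAllQAntipodalX2WordsGeneric
import HarnessLib

/-!
# Connectivity correlation inequalities for `φ_{w,q}` — the TYPE-WORD MODEL of `X2`, file 6: the hull ends of the PARTNER `ι x`
# (memo g13 Lemma 3.4)

Helper file (`--supports stmt-CriticalPhenomena-4575`), FK sub-lane `prim-bschramm-fk-2` (gen 13); builds on p205010 (kernel
theorem, internal audit signed; external expert review pending).  Pure finite combinatorics on the type-word model of
`…AntipodalX2Words` (memo `bschramm/FROM-fk-2-g13-WORD-HALL.md`).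
* `balF_head_W/P`, `balF_last_W/P`: at a BALANCED end whose hull block is fully flipped, the neighbouring block is ground and the
  relevant row of the rest is nonempty with the forced first/last letter (memo 3.4, bullets 2–3);
* `partner_left` / `partner_right`: for `z = E^s ++ mid.map swap ++ E^b` the hull of `z` starts at `s` (ends at `t`) with first (last)
  visible kinds = those of `mid` with the rows exchanged, except in the "trimmed" case (balanced end, flipped hull block) where it
  starts at `s+1` (ends at `t-1`) with visible kinds `(P, W)` — an unbalanced end of `z`.
[cite: Grimmett2006, §3.9 (p. 63)]
-/

namespace Summit.CriticalPhenomena.PercolationContinuityZ3.Theorems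

namespace FK

namespace X2Word

/-! ### A balanced end whose hull block is fully flipped (memo g13 3.4, bullets 2–3) -/

section BalancedF

/-- Balanced left end at a flipped `W`-block: the next block is a ground `P`-block, and row `A` of the rest starts with a wall. [folklore] -/
theorem balF_head_W {l : List Ty} (hA : rowA .W (.F :: l) ≠ [])
    (hbal : headP (rowA .W (.F :: l)) = headP (rowB .W (.F :: l))) :
    ∃ l₂, l = .E :: l₂ ∧ rowA .W l₂ ≠ [] ∧ headP (rowA .W l₂) = false ∧ rowA .W (.F :: l) = rowA .W l₂ := by
  have e1 : rowA .W (.F :: l) = rowA .P l := by simp [rowA_cons, visA]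
  have e2 : headP (rowB .W (.F :: l)) = false := by simp [rowB_cons, visB, headP]
  rw [e2, e1] at hbal; rw [e1] at hA
  cases l with
  | nil => exact absurd rfl hA
  | cons e l₂ =>
    cases e with
    | E =>
      have e3 : rowA .P (.E :: l₂) = rowA .W l₂ := by simp [rowA_cons, visA]
      rw [e3] at hA hbal
      exact ⟨l₂, rfl, hA, hbal, e1.trans e3⟩
    | M => simp [rowA_cons, visA, headP] at hbal
    | F => simp [rowA_cons, visA, headP] at hbal

/-- Balanced left end at a flipped `P`-block: the next block is a ground `W`-block, and row `B` of the rest starts with a particle. [folklore] -/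
theorem balF_head_P {l : List Ty} (hB : rowB .P (.F :: l) ≠ [])
    (hbal : headP (rowA .P (.F :: l)) = headP (rowB .P (.F :: l))) :
    ∃ l₂, l = .E :: l₂ ∧ rowB .P l₂ ≠ [] ∧ headP (rowB .P l₂) = true ∧ rowB .P (.F :: l) = rowB .P l₂ := by
  have e1 : rowB .P (.F :: l) = rowB .W l := by simp [rowB_cons, visB]
  have e2 : headP (rowA .P (.F :: l)) = true := by simp [rowA_cons, visA, headP]
  rw [e2, e1] at hbal; rw [e1] at hB
  cases l with
  | nil => exact absurd rfl hB
  | cons e l₂ =>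
    cases e with
    | E =>
      have e3 : rowB .W (.E :: l₂) = rowB .P l₂ := by simp [rowB_cons, visB]
      rw [e3] at hB hbal
      exact ⟨l₂, rfl, hB, hbal.symm, e1.trans e3⟩
    | M => simp [rowB_cons, visB, headP] at hbal
    | F => simp [rowB_cons, visB, headP] at hbal

/-- Mirror image: balanced right end at a flipped block of kind `W` (the kind of the LAST block): the block before it is a ground
`P`-block and row `A` of the rest ends with a wall. [folklore] -/
theorem balF_last_W {k : Kind} {l : List Ty} (hk : kindAt k l.length = .W) (hA : rowA k (l ++ [.F]) ≠ [])
    (hbal : lastP (rowA k (l ++ [.F])) = lastP (rowB k (l ++ [.F]))) :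
    ∃ l₂, l = l₂ ++ [.E] ∧ rowA k l₂ ≠ [] ∧ lastP (rowA k l₂) = false ∧ rowA k (l ++ [.F]) = rowA k l₂ := by
  have e1 : rowA k (l ++ [.F]) = rowA k l := by rw [rowA_append, rowA_singleton, hk]; simp [visA]
  have e2 : lastP (rowB k (l ++ [.F])) = false := by
    rw [rowB_append, rowB_singleton, hk]; simp [visB, lastP_concat]
  rw [e2, e1] at hbal; rw [e1] at hA
  rcases List.eq_nil_or_concat l with h0 | ⟨l₂, e, hl⟩
  · subst h0; exact absurd rfl hA
  · rw [List.concat_eq_append] at hl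
    subst hl
    have hk2 : kindAt k l₂.length = .P := by
      rw [List.length_append, List.length_singleton, kindAt_succ] at hk
      cases hq : kindAt k l₂.length <;> simp_all
    have e3 : rowA k (l₂ ++ [e]) = rowA k l₂ ++ (if visA .P e then [.P] else []) := by
      rw [rowA_append, rowA_singleton, hk2]
    cases e with
    | E =>
      have e4 : rowA k (l₂ ++ [.E]) = rowA k l₂ := by rw [e3]; simp [visA]
      rw [e4] at hA hbal
      exact ⟨l₂, rfl, hA, hbal, e1.trans e4⟩
    | M => rw [e3] at hbal; simp [visA, lastP_concat] at hbal
    | F => rw [e3] at hbal; simp [visA, lastP_concat] at hbal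

/-- Mirror image: balanced right end at a flipped block of kind `P`: the block before it is a ground `W`-block and row `B` of the rest
ends with a particle. [folklore] -/
theorem balF_last_P {k : Kind} {l : List Ty} (hk : kindAt k l.length = .P) (hB : rowB k (l ++ [.F]) ≠ [])
    (hbal : lastP (rowA k (l ++ [.F])) = lastP (rowB k (l ++ [.F]))) :
    ∃ l₂, l = l₂ ++ [.E] ∧ rowB k l₂ ≠ [] ∧ lastP (rowB k l₂) = true ∧ rowB k (l ++ [.F]) = rowB k l₂ := by
  have e1 : rowB k (l ++ [.F]) = rowB k l := by rw [rowB_append, rowB_singleton, hk]; simp [visB]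
  have e2 : lastP (rowA k (l ++ [.F])) = true := by
    rw [rowA_append, rowA_singleton, hk]; simp [visA, lastP_concat]
  rw [e2, e1] at hbal; rw [e1] at hB
  rcases List.eq_nil_or_concat l with h0 | ⟨l₂, e, hl⟩
  · subst h0; exact absurd rfl hB
  · rw [List.concat_eq_append] at hl
    subst hl
    have hk2 : kindAt k l₂.length = .W := by
      rw [List.length_append, List.length_singleton, kindAt_succ] at hk
      cases hq : kindAt k l₂.length <;> simp_all
    have e3 : rowB k (l₂ ++ [e]) = rowB k l₂ ++ (if visB .W e then [.W] else []) := by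
      rw [rowB_append, rowB_singleton, hk2]
    cases e with
    | E =>
      have e4 : rowB k (l₂ ++ [.E]) = rowB k l₂ := by rw [e3]; simp [visB]
      rw [e4] at hB hbal
      exact ⟨l₂, rfl, hB, hbal.symm, e1.trans e4⟩
    | M => rw [e3] at hbal; simp [visB, lastP_concat] at hbal
    | F => rw [e3] at hbal; simp [visB, lastP_concat] at hbal

end BalancedF

/-! ### The partner's hull and balance (memo g13 Lemma 3.4) -/

section PartnerEnds

/-- A nonempty row word that does not start with a particle starts with a wall. [folklore] -/
theorem head?_eq_W {l : List Kind} (hne : l ≠ []) (h : headP l = false) : l.head? = some .W := by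
  cases l with
  | nil => exact absurd rfl hne
  | cons a l => cases a <;> simp_all [headP]

/-- A row word that starts with a particle. [folklore] -/
theorem head?_eq_P {l : List Kind} (h : headP l = true) : l.head? = some .P := by
  simpa [headP] using h

/-- A nonempty row word that does not end with a particle ends with a wall. [folklore] -/
theorem getLast?_eq_W {l : List Kind} (hne : l ≠ []) (h : lastP l = false) : l.getLast? = some .W := by
  unfold lastP at h
  cases hl : l.getLast? with
  | none => exact absurd (List.getLast?_eq_none_iff.mp hl) hne
  | some a => cases a <;> simp_all

/-- A row word that ends with a particle. [folklore] -/
theorem getLast?_eq_P {l : List Kind} (h : lastP l = true) : l.getLast? = some .P := by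
  simpa [lastP] using h

variable {k₀ : Kind}

/-- LEFT END OF THE PARTNER (memo g13 3.4).  Let `z = E^s ++ mid.map swap ++ E^b` with `mid = (if bL then [] else [E]) ++ hp ++ R`,
`hp = e₀ :: hp₁`, `e₀ ≠ E`, the kind bookkeeping `hkk`, nonempty rows of `hp`, and the balance fact at a balanced left end.  Then the
hull of `z` starts at `s`, where the first visible kinds of `z` are those of `mid` with the rows exchanged — unless the left end is
balanced with `e₀ = F` ("trimmed"), in which case the hull of `z` starts at `s + 1` with first visible kinds `(P, W)` (unbalanced).
[folklore] -/
theorem partner_left (s b : ℕ) (bL : Bool) (k : Kind) (e₀ : Ty) (he₀ : e₀ ≠ .E) (hp₁ R mid z : List Ty)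
    (hmid : mid = (if bL then [] else [Ty.E]) ++ (e₀ :: hp₁) ++ R)
    (hz : z = List.replicate s Ty.E ++ mid.map Ty.swap ++ List.replicate b Ty.E)
    (hkk : (if bL then kindAt k₀ s else (kindAt k₀ s).other) = k)
    (hA : rowA k (e₀ :: hp₁) ≠ []) (hB : rowB k (e₀ :: hp₁) ≠ [])
    (hbal : bL = true → headP (rowA k (e₀ :: hp₁)) = headP (rowB k (e₀ :: hp₁)))
    (hmA : rowA (kindAt k₀ s) mid ≠ []) (hmB : rowB (kindAt k₀ s) mid ≠ []) :
    hullStart z = some (if (bL && decide (e₀ = .F)) then s + 1 else s) ∧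
    ((bL && decide (e₀ = .F)) = true → firstA k₀ z (s + 1) = some .P ∧ firstB k₀ z (s + 1) = some .W) ∧
    ((bL && decide (e₀ = .F)) = false →
      firstA k₀ z s = (rowB (kindAt k₀ s) mid).head? ∧ firstB k₀ z s = (rowA (kindAt k₀ s) mid).head?) := by
  have hzdrop : z.drop s = mid.map Ty.swap ++ List.replicate b .E := by
    rw [hz, List.append_assoc, List.drop_left' (by simp)]
  have hzs : hullStart z = (hullStart (mid.map Ty.swap ++ List.replicate b .E)).map (· + s) := by
    rw [hz, List.append_assoc, hullStart_replicate_append]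
  refine ⟨?_, ?_, ?_⟩
  · -- the hull start
    rw [hzs]
    cases hbL : bL with
    | false =>
      subst hbL
      have : mid.map Ty.swap ++ List.replicate b .E = .F :: ((e₀ :: hp₁ ++ R).map Ty.swap ++ List.replicate b .E) := by
        rw [hmid]; simp
      rw [this, hullStart_cons_of_ne (by decide)]
      simp
    | true =>
      subst hbL
      simp only [if_true] at hkk hmid
      cases e₀ with
      | E => exact absurd rfl he₀
      | M =>
        have : mid.map Ty.swap ++ List.replicate b .E = .M :: ((hp₁ ++ R).map Ty.swap ++ List.replicate b .E) := by
          rw [hmid]; simp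
        rw [this, hullStart_cons_of_ne (by decide)]
        simp
      | F =>
        obtain ⟨hp₂, rfl⟩ : ∃ hp₂, hp₁ = .E :: hp₂ := by
          cases hq : k with
          | W => subst hq; obtain ⟨hp₂, h1, -⟩ := balF_head_W hA (hbal rfl); exact ⟨hp₂, h1⟩
          | P => subst hq; obtain ⟨hp₂, h1, -⟩ := balF_head_P hB (hbal rfl); exact ⟨hp₂, h1⟩
        have : mid.map Ty.swap ++ List.replicate b .E = .E :: .F :: ((hp₂ ++ R).map Ty.swap ++ List.replicate b .E) := by
          rw [hmid]; simp
        rw [this, hullStart_cons_E, hullStart_cons_of_ne (by decide)]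
        simp [Nat.add_comm]
  · -- trimmed: unbalanced at `s + 1` with first visible kinds `(P, W)`
    intro ht
    obtain ⟨hbL, he⟩ := Bool.and_eq_true_iff.mp ht
    have he : e₀ = .F := of_decide_eq_true he
    subst hbL he
    simp only [if_true] at hkk hmid
    have hzdrop1 : z.drop (s + 1) = (hp₁ ++ R).map Ty.swap ++ List.replicate b .E := by
      rw [← List.drop_drop, hzdrop, hmid]; simp
    unfold firstA firstB
    rw [kindAt_succ, hkk, hzdrop1]
    cases hq : k with
    | W =>
      subst hq
      obtain ⟨hp₂, rfl, hA2, hh2, -⟩ := balF_head_W hA (hbal rfl)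
      have e1 : (Ty.E :: hp₂ ++ R).map Ty.swap ++ List.replicate b Ty.E =
          .F :: ((hp₂ ++ R).map Ty.swap ++ List.replicate b .E) := by simp
      rw [e1]
      constructor
      · simp [rowA_cons, visA]
      · have e2 : rowB Kind.W.other (Ty.F :: ((hp₂ ++ R).map Ty.swap ++ List.replicate b Ty.E)) =
            rowA .W hp₂ ++ (rowA (kindAt .W hp₂.length) R ++
              rowB (kindAt .W ((hp₂ ++ R).map Ty.swap).length) (List.replicate b .E)) := by
          simp only [Kind.other_W, rowB_cons, visB, List.map_append, rowB_append, rowB_map_swap, List.append_assoc,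
            List.length_map, List.length_append]
          simp only [kindAt, ← Function.iterate_add_apply, Nat.add_comm]
          simp
        rw [e2, head?_append_of_ne_nil _ hA2]
        exact head?_eq_W hA2 hh2
    | P =>
      subst hq
      obtain ⟨hp₂, rfl, hB2, hh2, -⟩ := balF_head_P hB (hbal rfl)
      have e1 : (Ty.E :: hp₂ ++ R).map Ty.swap ++ List.replicate b Ty.E =
          .F :: ((hp₂ ++ R).map Ty.swap ++ List.replicate b .E) := by simp
      rw [e1]
      constructor
      · have e2 : rowA Kind.P.other (Ty.F :: ((hp₂ ++ R).map Ty.swap ++ List.replicate b Ty.E)) =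
            rowB .P hp₂ ++ (rowB (kindAt .P hp₂.length) R ++
              rowA (kindAt .P ((hp₂ ++ R).map Ty.swap).length) (List.replicate b .E)) := by
          simp only [Kind.other_P, rowA_cons, visA, List.map_append, rowA_append, rowA_map_swap, List.append_assoc,
            List.length_map, List.length_append]
          simp only [kindAt, ← Function.iterate_add_apply, Nat.add_comm]
          simp
        rw [e2, head?_append_of_ne_nil _ hB2]
        exact head?_eq_P hh2
      · simp [rowB_cons, visB]
  · -- untrimmed: first visible kinds are those of `mid` with the rows exchanged
    intro _
    unfold firstA firstB
    rw [hzdrop]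
    simp only [rowA_append, rowB_append, rowA_map_swap, rowB_map_swap]
    rw [head?_append_of_ne_nil _ hmB, head?_append_of_ne_nil _ hmA]
    exact ⟨rfl, rfl⟩

/-- RIGHT END OF THE PARTNER (mirror image of `partner_left`).  With `mid = L ++ hp ++ (if bR then [] else [E])`, `hp = hp₁ ++ [e₁]`,
`e₁ ≠ E`, `k` the kind of the first block of `hp` and `kl` that of its last block: the hull of `z` ends at `t = s + |mid| - 1`, where the
last visible kinds of `z` are those of `mid` with the rows exchanged — unless the right end is balanced with `e₁ = F` ("trimmed"), in
which case it ends at `t - 1` with last visible kinds `(P, W)` (unbalanced). [folklore] -/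
theorem partner_right (s b : ℕ) (bR : Bool) (k kl : Kind) (e₁ : Ty) (he₁ : e₁ ≠ .E) (hp₁ L mid z : List Ty)
    (hmid : mid = L ++ (hp₁ ++ [e₁]) ++ (if bR then [] else [Ty.E]))
    (hz : z = List.replicate s Ty.E ++ mid.map Ty.swap ++ List.replicate b Ty.E)
    (hk : kindAt (kindAt k₀ s) L.length = k) (hkl : kindAt k hp₁.length = kl)
    (hA : rowA k (hp₁ ++ [e₁]) ≠ []) (hB : rowB k (hp₁ ++ [e₁]) ≠ [])
    (hbal : bR = true → lastP (rowA k (hp₁ ++ [e₁])) = lastP (rowB k (hp₁ ++ [e₁])))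
    (hmA : rowA (kindAt k₀ s) mid ≠ []) (hmB : rowB (kindAt k₀ s) mid ≠ []) :
    hullEnd z = some (if (bR && decide (e₁ = .F)) then s + mid.length - 2 else s + mid.length - 1) ∧
    ((bR && decide (e₁ = .F)) = true →
      lastA k₀ z (s + mid.length - 2) = some .P ∧ lastB k₀ z (s + mid.length - 2) = some .W) ∧
    ((bR && decide (e₁ = .F)) = false →
      lastA k₀ z (s + mid.length - 1) = (rowB (kindAt k₀ s) mid).getLast? ∧
        lastB k₀ z (s + mid.length - 1) = (rowA (kindAt k₀ s) mid).getLast?) := by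
  have hmlen : 1 ≤ mid.length := by rw [hmid]; simp only [List.length_append, List.length_cons]; omega
  have hztake : z.take (s + mid.length) = List.replicate s .E ++ mid.map Ty.swap := by
    rw [hz, List.take_left' (by simp)]
  have hze : hullEnd z = hullEnd (List.replicate s .E ++ mid.map Ty.swap) := by
    rw [hz, hullEnd_append_replicate]
  refine ⟨?_, ?_, ?_⟩
  · -- the hull end
    rw [hze]
    cases hbR : bR with
    | false =>
      subst hbR
      have : List.replicate s Ty.E ++ mid.map Ty.swap = (List.replicate s Ty.E ++ (L ++ (hp₁ ++ [e₁])).map Ty.swap) ++ [.F] := by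
        rw [hmid]; simp
      rw [this, hullEnd_concat_of_ne _ (by decide)]
      simp [hmid]; omega
    | true =>
      subst hbR
      simp only [if_true, List.append_nil] at hmid
      cases e₁ with
      | E => exact absurd rfl he₁
      | M =>
        have : List.replicate s Ty.E ++ mid.map Ty.swap = (List.replicate s Ty.E ++ (L ++ hp₁).map Ty.swap) ++ [.M] := by
          rw [hmid]; simp
        rw [this, hullEnd_concat_of_ne _ (by decide)]
        simp [hmid]; omega
      | F =>
        obtain ⟨hp₂, rfl⟩ : ∃ hp₂, hp₁ = hp₂ ++ [.E] := by
          cases hq : kl with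
          | W => obtain ⟨hp₂, h1, -⟩ := balF_last_W (hkl.trans hq) hA (hbal rfl); exact ⟨hp₂, h1⟩
          | P => obtain ⟨hp₂, h1, -⟩ := balF_last_P (hkl.trans hq) hB (hbal rfl); exact ⟨hp₂, h1⟩
        have : List.replicate s Ty.E ++ mid.map Ty.swap =
            ((List.replicate s Ty.E ++ (L ++ hp₂).map Ty.swap) ++ [.F]) ++ List.replicate 1 .E := by
          rw [hmid]; simp
        rw [this, hullEnd_append_replicate, hullEnd_concat_of_ne _ (by decide)]
        simp [hmid]; omega
  · -- trimmed: unbalanced at `t - 1` with last visible kinds `(P, W)`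
    intro ht
    obtain ⟨hbR, he⟩ := Bool.and_eq_true_iff.mp ht
    have he : e₁ = .F := of_decide_eq_true he
    subst hbR he
    simp only [if_true, List.append_nil] at hmid
    obtain ⟨hp₂, rfl, hrow2, hl2, -⟩ :
        ∃ hp₂, hp₁ = hp₂ ++ [.E] ∧ (kl = .W → rowA k hp₂ ≠ [] ∧ lastP (rowA k hp₂) = false) ∧
          (kl = .P → rowB k hp₂ ≠ [] ∧ lastP (rowB k hp₂) = true) ∧ True := by
      cases hq : kl with
      | W =>
        obtain ⟨hp₂, h1, h2, h3, -⟩ := balF_last_W (hkl.trans hq) hA (hbal rfl)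
        exact ⟨hp₂, h1, fun _ => ⟨h2, h3⟩, fun h => absurd h (by decide), trivial⟩
      | P =>
        obtain ⟨hp₂, h1, h2, h3, -⟩ := balF_last_P (hkl.trans hq) hB (hbal rfl)
        exact ⟨hp₂, h1, fun h => absurd h (by decide), fun _ => ⟨h2, h3⟩, trivial⟩
    have hkl2 : kindAt k hp₂.length = kl.other := by
      rw [← hkl, List.length_append, List.length_singleton, kindAt_succ, Kind.other_other]
    have hlen2 : s + mid.length - 2 + 1 = s + (L ++ hp₂ ++ [Ty.E]).length := by rw [hmid]; simp; omega
    have hz' : z = (List.replicate s .E ++ (L ++ hp₂ ++ [Ty.E]).map Ty.swap) ++ (Ty.E :: List.replicate b .E) := by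
      rw [hz, hmid]; simp
    have hztake2 : z.take (s + mid.length - 2 + 1) = List.replicate s .E ++ (L ++ hp₂ ++ [Ty.E]).map Ty.swap := by
      rw [hlen2, hz', List.take_left' (by simp)]
    unfold lastA lastB
    rw [hztake2, rowA_append, rowB_append, rowA_map_swap, rowB_map_swap, List.length_replicate]
    simp only [rowA_append, rowB_append, hk, List.length_append, kindAt_add, hkl2, rowA_singleton, rowB_singleton]
    cases hq : kl with
    | W =>
      obtain ⟨hA2, hl2'⟩ := hrow2 hq
      constructor
      · simp [visB]
      · simp only [Kind.other_W, visA, show decide (Ty.E ≠ Ty.E) = false from rfl, Bool.false_eq_true, if_false,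
          List.append_nil]
        rw [← List.append_assoc, getLast?_append_of_ne_nil' _ hA2]
        exact getLast?_eq_W hA2 hl2'
    | P =>
      obtain ⟨hB2, hl2'⟩ := hl2 hq
      constructor
      · simp only [Kind.other_P, visB, show decide (Ty.E ≠ Ty.E) = false from rfl, Bool.false_eq_true, if_false,
          List.append_nil]
        rw [← List.append_assoc, getLast?_append_of_ne_nil' _ hB2]
        exact getLast?_eq_P hl2'
      · simp [visA]
  · -- untrimmed: last visible kinds are those of `mid` with the rows exchanged
    intro _
    have hlen1 : s + mid.length - 1 + 1 = s + mid.length := by omega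
    unfold lastA lastB
    rw [hlen1, hztake, rowA_append, rowB_append, rowA_map_swap, rowB_map_swap, List.length_replicate,
      getLast?_append_of_ne_nil' _ hmB, getLast?_append_of_ne_nil' _ hmA]
    exact ⟨rfl, rfl⟩

end PartnerEnds


end X2Word

end FK

end Summit.CriticalPhenomena.PercolationContinuityZ3.Theorems
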